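import Summits.MatrixMultiplication.OmegaCensus.BoxUsefulNormalTwoSubgroup
import Summits.MatrixMultiplication.OmegaCensus.BoxBadDihC3CubeConfig
import Summits.MatrixMultiplication.OmegaCensus.BoxUsefulOddSylowAbelian

/-!
# ω-census, family (b3): conjecture C9 (b) — minimal normal `3`-subgroups of a centreless box-useful `{2,3}`-group are inverted and have rank `≤ 2`

HONEST FRAMING (pub-omega census; verbatim): lottery ticket; floor = certified bounds/negative ranges.
Census BOOKKEEPING (conjecture C9 of the cell, STRUCTURE.md §2; pub-omega kernel-l4 gen 16, task K-5, structure part; the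
`p = 3` half of the centreless branch, first file).  `G` is a finite box-useful group of order `2^a 3^b` with `Z(G) = 1`, and
`V ⊴ G` is a MINIMAL normal subgroup which is an elementary abelian `3`-group (`v³ = 1`, `V` abelian).
* `TwoThree.three_elt_comm_of_normal_exp_three`: every element of `3`-power order centralises `V` (it lies in a Sylow
  `3`-subgroup, which contains the normal `3`-subgroup `V` and is abelian, `OddPGroup.sylow_comm_of_boxUseful`).
* `TwoThree.exists_inverter`: some `t ∈ G` inverts `V` (`t v t⁻¹ = v⁻¹` for all `v ∈ V`).  *Proof:* `C = C_G(V) ⊉ P` for a Sylow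
  `2`-subgroup `P` (else `V` central); a central involution `t̄` of `P/(P ∩ C)` gives `t` with `t² ∈ C`, `⁅t, P⁆ ⊆ C`; the
  subgroup `{v · tvt⁻¹}` is normal (`G = P·C`) and `t`-fixed, so by minimality it is trivial.
* `TwoThree.no_three_independent`: `V` contains no three independent elements (`DihC3CubeConfig` with that `t`), i.e. `|V| ≤ 9`.
Nothing here is progress on `ω`.
-/

namespace Summit.MatrixMultiplication.OmegaCensus

open Finset ProductBoxBound
open scoped commutatorElement

namespace TwoThree

variable {G : Type*} [Group G] [Fintype G] [DecidableEq G]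

/-- **`3`-elements centralise normal elementary abelian `3`-subgroups of a box-useful group.** [folklore] -/
theorem three_elt_comm_of_normal_exp_three (hG : BoxUseful G) (V : Subgroup G) [hVn : V.Normal]
    (hV3 : ∀ v ∈ V, v ^ 3 = 1) {t : G} {k : ℕ} (ht : t ^ 3 ^ k = 1) : ∀ v ∈ V, t * v = v * t := by
  classical
  haveI : Fact (Nat.Prime 3) := ⟨Nat.prime_three⟩
  -- `V` and `⟨t⟩` are `3`-groups
  have hV : IsPGroup 3 V := by
    intro v; refine ⟨1, ?_⟩; apply Subtype.ext; rw [pow_one]; exact hV3 v v.2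
  have hT : IsPGroup 3 (Subgroup.zpowers t) := by
    obtain ⟨c, -, hc⟩ := (Nat.dvd_prime_pow Nat.prime_three).1 (orderOf_dvd_of_pow_eq_one ht)
    exact IsPGroup.of_card (by rw [Nat.card_zpowers, hc])
  obtain ⟨T₀, hT₀⟩ := hV.exists_le_sylow
  obtain ⟨T, hTt⟩ := hT.exists_le_sylow
  obtain ⟨x, hx⟩ := MulAction.exists_smul_eq G T₀ T
  -- `V = x V x⁻¹ ≤ x T₀ x⁻¹ = T`
  have hVT : V ≤ (T : Subgroup G) := by
    intro v hv
    have e : ((x • T₀ : Sylow 3 G) : Subgroup G) = (T : Subgroup G) := congrArg (fun R : Sylow 3 G => (R : Subgroup G)) hx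
    rw [Sylow.coe_subgroup_smul] at e
    rw [← e]
    have hv' : x⁻¹ * v * x⁻¹⁻¹ ∈ V := hVn.conj_mem v hv x⁻¹
    have := Subgroup.smul_mem_pointwise_smul _ (MulAut.conj x) (T₀ : Subgroup G) (hT₀ hv')
    simpa [MulAut.smul_def, MulAut.conj_apply, mul_assoc] using this
  intro v hv
  exact OddPGroup.sylow_comm_of_boxUseful (by decide : Odd 3) hG T _ _ (hTt (Subgroup.mem_zpowers t)) (hVT hv)

omit [DecidableEq G] in
/-- In a `{2,3}`-group, `G = P · C` for a Sylow `2`-subgroup `P` and any normal subgroup `C` containing every element of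
`3`-power order. [folklore] -/
theorem exists_mul_of_sylow_normal (h23 : ∀ q : ℕ, q.Prime → q ∣ Fintype.card G → q = 2 ∨ q = 3) (P : Sylow 2 G)
    (C : Subgroup G) [C.Normal] (hC3 : ∀ (t : G) (k : ℕ), t ^ 3 ^ k = 1 → t ∈ C) (g : G) :
    ∃ p ∈ (P : Subgroup G), ∃ c ∈ C, p * c = g := by
  classical
  haveI : Fact (Nat.Prime 3) := ⟨Nat.prime_three⟩
  obtain ⟨T⟩ : Nonempty (Sylow 3 G) := inferInstance
  have hTC : (T : Subgroup G) ≤ C := by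
    intro t ht
    obtain ⟨k, hk⟩ := IsPGroup.iff_orderOf.mp T.isPGroup' ⟨t, ht⟩
    rw [Subgroup.orderOf_mk] at hk
    exact hC3 t k (by rw [← hk]; exact pow_orderOf_eq_one t)
  have htop : (P : Subgroup G) ⊔ C = ⊤ :=
    eq_top_of_sylow_le h23 _ P T le_sup_left (hTC.trans le_sup_right)
  have hg : g ∈ (P : Subgroup G) ⊔ C := by rw [htop]; exact Subgroup.mem_top g
  rw [← SetLike.mem_coe, Subgroup.mul_normal, Set.mem_mul] at hg
  obtain ⟨p, hp, c, hc, e⟩ := hg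
  exact ⟨p, hp, c, hc, e⟩

/-- **A minimal normal elementary abelian `3`-subgroup of a centreless box-useful `{2,3}`-group is inverted by some element.**
[folklore] -/
theorem exists_inverter (hG : BoxUseful G) (h23 : ∀ q : ℕ, q.Prime → q ∣ Fintype.card G → q = 2 ∨ q = 3)
    (hZ : Subgroup.center G = ⊥) (V : Subgroup G) [hVn : V.Normal] (hV3 : ∀ v ∈ V, v ^ 3 = 1)
    (hVab : ∀ v ∈ V, ∀ w ∈ V, v * w = w * v) (hV1 : V ≠ ⊥)
    (hVmin : ∀ W : Subgroup G, W.Normal → W ≤ V → W = ⊥ ∨ W = V) :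
    ∃ t : G, ∀ v ∈ V, t * v * t⁻¹ = v⁻¹ := by
  classical
  haveI : Fact (Nat.Prime 2) := ⟨Nat.prime_two⟩
  obtain ⟨P⟩ : Nonempty (Sylow 2 G) := inferInstance
  set C : Subgroup G := Subgroup.centralizer (V : Set G) with hC
  haveI hCn : C.Normal := by rw [hC]; exact Subgroup.normal_centralizer
  have memC : ∀ g : G, g ∈ C ↔ ∀ v ∈ V, g * v = v * g := by
    intro g; rw [hC, Subgroup.mem_centralizer_iff]
    exact ⟨fun h v hv => (h v hv).symm, fun h v hv => (h v hv).symm⟩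
  have hC3 : ∀ (t : G) (k : ℕ), t ^ 3 ^ k = 1 → t ∈ C := fun t k ht =>
    (memC t).2 (three_elt_comm_of_normal_exp_three hG V hV3 ht)
  -- `P ⊄ C` (else `V` would be central)
  have hPC : ¬ (P : Subgroup G) ≤ C := by
    intro hle
    obtain ⟨v, hv, hv1⟩ : ∃ v ∈ V, v ≠ (1 : G) := by
      by_contra! hall; exact hV1 ((Subgroup.eq_bot_iff_forall _).2 hall)
    apply hv1
    have : v ∈ Subgroup.center G := by
      rw [Subgroup.mem_center_iff]; intro g
      obtain ⟨p, hp, c, hc, rfl⟩ := exists_mul_of_sylow_normal h23 P C hC3 g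
      have h1 := (memC p).1 (hle hp) v hv
      have h2 := (memC c).1 hc v hv
      calc p * c * v = p * (c * v) := mul_assoc _ _ _
        _ = p * (v * c) := by rw [h2]
        _ = (p * v) * c := (mul_assoc _ _ _).symm
        _ = v * p * c := by rw [h1]
        _ = v * (p * c) := mul_assoc _ _ _
    rwa [hZ, Subgroup.mem_bot] at this
  -- the `2`-group `Q = P / (P ∩ C)` and a central involution of it
  set K : Subgroup (P : Subgroup G) := C.subgroupOf (P : Subgroup G) with hK
  haveI hKn : K.Normal := by rw [hK]; infer_instance
  obtain ⟨p₀, hp₀P, hp₀C⟩ : ∃ p₀ ∈ (P : Subgroup G), p₀ ∉ C := by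
    by_contra! hall; exact hPC hall
  let πK : (P : Subgroup G) →* (P : Subgroup G) ⧸ K := QuotientGroup.mk' K
  have memK : ∀ p : (P : Subgroup G), πK p = 1 ↔ (p : G) ∈ C := by
    intro p; rw [QuotientGroup.mk'_apply, QuotientGroup.eq_one_iff, hK, Subgroup.mem_subgroupOf]
  haveI : Nontrivial ((P : Subgroup G) ⧸ K) :=
    ⟨⟨πK ⟨p₀, hp₀P⟩, 1, fun h => hp₀C ((memK _).1 h)⟩⟩
  have hQ : IsPGroup 2 ((P : Subgroup G) ⧸ K) := P.isPGroup'.to_quotient K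
  haveI hcnt : Nontrivial (Subgroup.center ((P : Subgroup G) ⧸ K)) := IsPGroup.center_nontrivial hQ
  obtain ⟨⟨z, hz⟩, hz1⟩ := exists_ne (1 : Subgroup.center ((P : Subgroup G) ⧸ K))
  have hz1' : z ≠ 1 := fun e => hz1 (Subtype.ext e)
  -- an element of order `2` in the centre: a power of `z`
  obtain ⟨e, he⟩ := IsPGroup.iff_orderOf.mp hQ z
  have he1 : 1 ≤ e := by
    by_contra h0
    have : e = 0 := by omega
    rw [this, pow_zero, orderOf_eq_one_iff] at he; exact hz1' he
  set z₂ := z ^ 2 ^ (e - 1) with hz₂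
  have hz₂ord : orderOf z₂ = 2 := by
    rw [hz₂, orderOf_pow' z (pow_ne_zero _ two_ne_zero), he, Nat.gcd_eq_right (pow_dvd_pow 2 (by omega)),
      Nat.pow_div (by omega) (by norm_num)]
    have : e - (e - 1) = 1 := by omega
    rw [this, pow_one]
  have hz₂c : z₂ ∈ Subgroup.center ((P : Subgroup G) ⧸ K) := Subgroup.pow_mem _ hz _
  have hz₂1 : z₂ ≠ 1 := fun h => by rw [h, orderOf_one] at hz₂ord; exact absurd hz₂ord (by norm_num)
  have hz₂2 : z₂ ^ 2 = 1 := by have := pow_orderOf_eq_one z₂; rwa [hz₂ord] at this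
  obtain ⟨tP, htP⟩ := QuotientGroup.mk'_surjective K z₂
  set t : G := (tP : G) with htdef
  have htP' : t ∈ (P : Subgroup G) := tP.2
  have htC : t ∉ C := fun h => hz₂1 (by rw [← htP]; exact (memK tP).2 h)
  have ht2C : t * t ∈ C := by
    have : πK (tP * tP) = 1 := by rw [map_mul, htP, ← pow_two, hz₂2]
    exact (memK _).1 this
  have htcomm : ∀ p ∈ (P : Subgroup G), t * p * t⁻¹ * p⁻¹ ∈ C := by
    intro p hp
    have hc := Subgroup.mem_center_iff.mp hz₂c (πK ⟨p, hp⟩)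
    have : πK (tP * ⟨p, hp⟩ * tP⁻¹ * ⟨p, hp⟩⁻¹) = 1 := by
      rw [map_mul, map_mul, map_mul, map_inv, map_inv, htP, ← hc]; group
    exact (memK _).1 this
  -- the normal subgroup `W = {v · t v t⁻¹}` is `t`-fixed, hence trivial by minimality
  have ht2 : ∀ v ∈ V, t * t * v * (t * t)⁻¹ = v := fun v hv => by
    rw [(memC _).1 ht2C v hv]; group
  have hVconj : ∀ g v : G, v ∈ V → g * v * g⁻¹ ∈ V := fun g v hv => hVn.conj_mem v hv g
  let φ : G → G := fun v => v * (t * v * t⁻¹)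
  have hφV : ∀ v ∈ V, φ v ∈ V := fun v hv => V.mul_mem hv (hVconj t v hv)
  have hφmul : ∀ v ∈ V, ∀ w ∈ V, φ (v * w) = φ v * φ w := by
    intro v hv w hw
    change v * w * (t * (v * w) * t⁻¹) = v * (t * v * t⁻¹) * (w * (t * w * t⁻¹))
    have e1 : t * (v * w) * t⁻¹ = (t * v * t⁻¹) * (t * w * t⁻¹) := by group
    rw [e1]
    calc v * w * (t * v * t⁻¹ * (t * w * t⁻¹)) = v * (w * (t * v * t⁻¹)) * (t * w * t⁻¹) := by group
      _ = v * (t * v * t⁻¹ * w) * (t * w * t⁻¹) := by rw [hVab w hw (t * v * t⁻¹) (hVconj t v hv)]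
      _ = v * (t * v * t⁻¹) * (w * (t * w * t⁻¹)) := by group
  -- `W` as a subgroup
  let W : Subgroup G :=
    { carrier := {x | ∃ v ∈ V, φ v = x}
      one_mem' := ⟨1, V.one_mem, by change (1 : G) * (t * 1 * t⁻¹) = 1; group⟩
      mul_mem' := by
        rintro x y ⟨v, hv, rfl⟩ ⟨w, hw, rfl⟩
        exact ⟨v * w, V.mul_mem hv hw, hφmul v hv w hw⟩
      inv_mem' := by
        rintro x ⟨v, hv, rfl⟩
        refine ⟨v⁻¹, V.inv_mem hv, ?_⟩
        have e := hφmul v⁻¹ (V.inv_mem hv) v hv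
        rw [inv_mul_cancel] at e
        have h1 : φ 1 = 1 := by change (1 : G) * (t * 1 * t⁻¹) = 1; group
        rw [h1] at e
        exact eq_inv_of_mul_eq_one_left e.symm }
  have hWV : W ≤ V := by rintro x ⟨v, hv, rfl⟩; exact hφV v hv
  -- `W` is normal: invariant under `P` (as `⁅t, P⁆ ⊆ C`) and under `C`
  have hWP : ∀ p ∈ (P : Subgroup G), ∀ x ∈ W, p * x * p⁻¹ ∈ W := by
    rintro p hp x ⟨v, hv, rfl⟩
    refine ⟨p * v * p⁻¹, hVconj p v hv, ?_⟩
    change p * v * p⁻¹ * (t * (p * v * p⁻¹) * t⁻¹) = p * (v * (t * v * t⁻¹)) * p⁻¹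
    -- `t p = c p t` with `c = t p t⁻¹ p⁻¹ ∈ C` centralising `p v p⁻¹`
    have hc := (memC _).1 (htcomm p hp) (p * v * p⁻¹) (hVconj p v hv)
    calc p * v * p⁻¹ * (t * (p * v * p⁻¹) * t⁻¹)
        = p * v * p⁻¹ * ((t * p * t⁻¹ * p⁻¹) * (p * (t * v * t⁻¹) * p⁻¹) * (t * p * t⁻¹ * p⁻¹)⁻¹) := by group
      _ = p * v * p⁻¹ * ((p * (t * v * t⁻¹) * p⁻¹) * (t * p * t⁻¹ * p⁻¹) * (t * p * t⁻¹ * p⁻¹)⁻¹) := by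
          rw [(memC _).1 (htcomm p hp) _ (hVconj p _ (hVconj t v hv))]
      _ = p * (v * (t * v * t⁻¹)) * p⁻¹ := by group
  have hWC : ∀ c ∈ C, ∀ x ∈ W, c * x * c⁻¹ ∈ W := by
    rintro c hc x ⟨v, hv, rfl⟩
    refine ⟨v, hv, ?_⟩
    rw [(memC c).1 hc (φ v) (hφV v hv)]; group
  haveI hWn : W.Normal := ⟨by
    intro x hx g
    obtain ⟨p, hp, c, hc, rfl⟩ := exists_mul_of_sylow_normal h23 P C hC3 g
    have h1 := hWC c hc x hx
    have h2 := hWP p hp _ h1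
    rw [mul_inv_rev, show p * c * x * (c⁻¹ * p⁻¹) = p * (c * x * c⁻¹) * p⁻¹ by group]
    exact h2⟩
  -- every element of `W` is `t`-fixed, so `W ≠ V`; hence `W = ⊥`
  have hWfix : ∀ x ∈ W, t * x * t⁻¹ = x := by
    rintro x ⟨v, hv, rfl⟩
    change t * (v * (t * v * t⁻¹)) * t⁻¹ = v * (t * v * t⁻¹)
    calc t * (v * (t * v * t⁻¹)) * t⁻¹ = (t * v * t⁻¹) * (t * t * v * (t * t)⁻¹) := by group
      _ = (t * v * t⁻¹) * v := by rw [ht2 v hv]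
      _ = v * (t * v * t⁻¹) := hVab _ (hVconj t v hv) _ hv
  rcases hVmin W hWn hWV with hbot | htop
  · refine ⟨t, fun v hv => ?_⟩
    have : φ v ∈ W := ⟨v, hv, rfl⟩
    rw [hbot, Subgroup.mem_bot] at this
    change v * (t * v * t⁻¹) = 1 at this
    exact (eq_inv_of_mul_eq_one_right this)
  · exfalso; apply htC
    rw [memC]
    intro v hv
    have hvW : v ∈ W := by rw [htop]; exact hv
    have := hWfix v hvW
    calc t * v = t * v * t⁻¹ * t := by group
      _ = v * t := by rw [this]

/-- **No three independent elements**: a minimal normal elementary abelian `3`-subgroup of a centreless box-useful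
`{2,3}`-group has order `≤ 9`. [folklore] -/
theorem no_three_independent (hG : BoxUseful G) (h23 : ∀ q : ℕ, q.Prime → q ∣ Fintype.card G → q = 2 ∨ q = 3)
    (hZ : Subgroup.center G = ⊥) (V : Subgroup G) [V.Normal] (hV3 : ∀ v ∈ V, v ^ 3 = 1)
    (hVab : ∀ v ∈ V, ∀ w ∈ V, v * w = w * v) (hV1 : V ≠ ⊥)
    (hVmin : ∀ W : Subgroup G, W.Normal → W ≤ V → W = ⊥ ∨ W = V) {a₁ a₂ a₃ : G} (h₁ : a₁ ∈ V) (h₂ : a₂ ∈ V)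
    (h₃ : a₃ ∈ V) (hind : ∀ p q r : ℕ, p < 3 → q < 3 → r < 3 → a₁ ^ p * (a₂ ^ q * a₃ ^ r) = 1 → p = 0 ∧ q = 0 ∧ r = 0) :
    False := by
  obtain ⟨t, ht⟩ := exists_inverter hG h23 hZ V hV3 hVab hV1 hVmin
  exact DihC3CubeConfig.not_boxUseful (hV3 a₁ h₁) (hV3 a₂ h₂) (hV3 a₃ h₃) (hVab _ h₁ _ h₂) (hVab _ h₁ _ h₃)
    (hVab _ h₂ _ h₃) hind (ht a₁ h₁) (ht a₂ h₂) (ht a₃ h₃) hG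

end TwoThree

end Summit.MatrixMultiplication.OmegaCensus
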